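import Literature.Computability.FineGrained.LCSFromOVBlocks
import HarnessLib

/-!
# OV → binary edit distance on the word RAM, I: the range dispatch of an alignment-gadget period

Generic structured word-RAM code (`SProg`, logic `SProg.Achieves` of
`…Cryptography.WordRAMAchieves`, certificates in the standard shape `LCSRed.Post` of
`…FineGrained.LCSFromOVBlocks`) used by the reduction program of
`Literature.Computability.FineGrained.EditDistOVProgram`, which writes the strings of
Bringmann–Künnemann's OV → EDIT reduction (FOCS 2015, §3.1 with Lemma 5.3) one bit per loop
iteration. The period of the edit-distance alignment gadget is
`G(z) 0^{γ₂} = 1^{γ} 0^{γ} 1^{γ} 0^{γ} z 0^{γ} 1^{γ} 0^{γ} 1^{γ} 0^{γ₂}` (`γ = γ₁`, `ρ = 2`); instead of a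
ten-way range dispatch the program uses arithmetic on the offset `r`:

* `EDRed.edWay rr tgt g₁ g₂ b₁ b₂ b₃ inner`: with the values `γ, 2γ, 4γ, 4γ + ℓ, 8γ + ℓ` in the
  registers `g₁, g₂, b₁, b₂, b₃`: for `r < 4γ` write the bit `[r mod 2γ < γ]`; for
  `4γ ≤ r < 4γ + ℓ` set `rr := r - 4γ` and run `inner` (the range of `z`); for
  `4γ + ℓ ≤ r < 8γ + ℓ` write `[¬ ((r - (4γ + ℓ)) mod 2γ < γ)]`; else write `0`;
* `EDRed.edBit`: the bit so selected; certificate `EDRed.edWay_spec` (`inner`'s certificate in,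
  `7` extra steps; registers `2` (tests) and `20` (the arithmetic bit) are written).

The `y`-string's zero paddings are dispatched by `LCSRed.threeWay` (reused as is).

[folklore] engineering (Nipkow–Klein, *Concrete Semantics*, §12: structured programs by rules).
-/

namespace Literature.Computability.FineGrained.EDRed

open Cryptography Cryptography.WordRAM Cryptography.WordRAM.SProg LCSRed

/-! ### The dispatch of a period -/

/-- **Dispatch of an alignment-gadget period** on the offset `r` (register `rr`): registers
`g₁ = γ`, `g₂ = 2γ`, `b₁ = 4γ`, `b₂ = 4γ + ℓ`, `b₃ = 8γ + ℓ`; the prefix `(1^γ 0^γ)²` is the bit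
`[r mod 2γ < γ]`, the suffix `(0^γ 1^γ)²` the bit `[¬ ((r - b₂) mod 2γ < γ)]`, the block `z` is
`inner` on `rr := r - b₁`, the separator is `0`. Register `2` holds the tests, register `20` the
arithmetic bit. [folklore] -/
def edWay (rr tgt g₁ g₂ b₁ b₂ b₃ : ℕ) (inner : SProg) : SProg :=
  seq (op .lt (r 2) (r rr) (r b₁)) <|
  ifz (r 2)
    (seq (op .lt (r 2) (r rr) (r b₂)) <|
     ifz (r 2)
       (seq (op .lt (r 2) (r rr) (r b₃)) <|
        ifz (r 2)
          (op .add (pt tgt) (im 0) (im 0))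
          (block [(.sub, r 20, r rr, r b₂), (.mod, r 20, r 20, r g₂), (.lt, r 20, r 20, r g₁),
            (.lt, r 20, r 20, im 1), (.add, pt tgt, r 20, im 0)]))
       (seq (op .sub (r rr) (r rr) (r b₁)) inner))
    (block [(.mod, r 20, r rr, r g₂), (.lt, r 20, r 20, r g₁), (.add, pt tgt, r 20, im 0)])

/-- `edWay` is query-free if `inner` is. [folklore] -/
theorem edWay_queryFree {rr tgt g₁ g₂ b₁ b₂ b₃ : ℕ} {inner : SProg} (h : inner.QueryFree) :
    (edWay rr tgt g₁ g₂ b₁ b₂ b₃ inner).QueryFree := by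
  simp only [edWay, QueryFree, block_queryFree]; tauto

/-- The bit selected by the dispatch, from the VALUES `vg₁ = γ`, `vg₂ = 2γ`, `v₁, v₂, v₃` of the
boundary registers: the prefix bit, bit `r - v₁` of `z` (given by `zb`), the suffix bit, or `0`.
[folklore] -/
def edBit (vg₁ vg₂ v₁ v₂ v₃ : ℕ) (zb : ℕ → Bool) (r : ℕ) : Bool :=
  if r < v₁ then decide (r % vg₂ < vg₁)
  else if r < v₂ then zb (r - v₁)
  else if r < v₃ then !decide ((r - v₂) % vg₂ < vg₁)
  else false

/-- Negating a Boolean word by the test `[x < 1]`. [folklore] -/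
theorem decide_toNat_lt_one (b : Bool) : decide (b.toNat < 1) = !b := by
  cases b <;> rfl

/-- A comparison as a Boolean word. [folklore] -/
theorem ite_eq_toNat_decide (c : Prop) [Decidable c] : (if c then 1 else 0) = (decide c).toNat := by
  by_cases hc : c <;> simp [hc]

/-- **Certificate of the dispatch.** Registers: `rr` holds `rv`, `tgt` a data address, `g₁, g₂, b₁,
b₂, b₃` the values `vg₁, vg₂, v₁, v₂, v₃`, all registers below `100`, distinct from the test
register `2` (and `tgt, g₁, g₂` from the scratch register `20`), `rr ≠ tgt, b₁, b₂, b₃`. If, whenever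
`v₁ ≤ rv < v₂`, `inner` — started on any register file agreeing with `R` outside `2, rr`, with
`rr = rv - v₁` — writes the word of `zb (rv - v₁)` into the target cell within `Tin ≥ 7` steps
keeping the registers outside `Sin`, then `edWay` writes the word of `edBit vg₁ vg₂ v₁ v₂ v₃ zb rv`
within `Tin + 7` steps keeping the registers outside `2 :: 20 :: rr :: Sin`. [folklore] -/
theorem edWay_spec {W : ℕ} {O : List ℕ → List ℕ} {rr tgt g₁ g₂ b₁ b₂ b₃ : ℕ} {inner : SProg}
    {R H : ℕ → ℕ} {rv vg₁ vg₂ v₁ v₂ v₃ Tin : ℕ} {zb : ℕ → Bool} {Sin : List ℕ}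
    (hrr : rr < 100) (htgt : tgt < 100) (hg₁ : g₁ < 100) (hg₂ : g₂ < 100) (hb₁ : b₁ < 100)
    (hb₂ : b₂ < 100) (hb₃ : b₃ < 100)
    (hrr2 : rr ≠ 2) (htgt2 : tgt ≠ 2) (htgt20 : tgt ≠ 20) (hrrt : rr ≠ tgt)
    (hg₁2 : g₁ ≠ 2) (hg₁20 : g₁ ≠ 20) (hg₂2 : g₂ ≠ 2) (hg₂20 : g₂ ≠ 20)
    (hb₁2 : b₁ ≠ 2) (hb₂2 : b₂ ≠ 2) (hb₃2 : b₃ ≠ 2)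
    (hb₁r : b₁ ≠ rr) (hb₂r : b₂ ≠ rr) (hb₃r : b₃ ≠ rr)
    (hRr : R rr = rv) (hRg₁ : R g₁ = vg₁) (hRg₂ : R g₂ = vg₂) (hR₁ : R b₁ = v₁) (hR₂ : R b₂ = v₂)
    (hR₃ : R b₃ = v₃) (hT : 100 ≤ R tgt) (hW : 2 ≤ 2 ^ W) (hrv : rv < 2 ^ W) (hTin : 7 ≤ Tin)
    (hinner : v₁ ≤ rv → rv < v₂ → ∀ R', Kept [2, rr] R R' → R' rr = rv - v₁ →
      Achieves W O inner (merge R' H)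
        (Post Sin R' (Function.update H (R tgt) (zb (rv - v₁)).toNat)) Tin) :
    Achieves W O (edWay rr tgt g₁ g₂ b₁ b₂ b₃ inner) (merge R H)
      (Post (2 :: 20 :: rr :: Sin) R (Function.update H (R tgt) (edBit vg₁ vg₂ v₁ v₂ v₃ zb rv).toNat))
      (Tin + 7) := by
  have h22 : (2 : ℕ) ∈ [2, rr] := by simp
  -- one dispatch level: test, then branch
  have level : ∀ {R' : ℕ → ℕ} {b vb : ℕ} {s u : SProg} {Q : (ℕ → ℕ) → Prop} {T : ℕ},
      b < 100 → b ≠ 2 → b ≠ rr → Kept [2, rr] R R' → R' rr = rv → R b = vb →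
      (¬ rv < vb → Achieves W O s (merge (Function.update R' 2 (if rv < vb then 1 else 0)) H) Q T) →
      (rv < vb → Achieves W O u (merge (Function.update R' 2 (if rv < vb then 1 else 0)) H) Q T) →
      Achieves W O (seq (op .lt (r 2) (r rr) (r b)) (ifz (r 2) s u)) (merge R' H) Q (1 + (T + 2)) := by
    intro R' b vb s u Q T hb hb2 hbr hK hR'r hRb h0 h1
    have hR'b : R' b = vb := (hK b (by simp [hb2, hbr])).trans hRb
    refine Achieves.seq (achieves_test hrr hb hR'r hR'b) fun m hm => ?_
    subst hm
    exact Achieves.ifz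
      (fun hz => h0 fun hlt => absurd hz ((test_read (R := R') (H := H) (c := rv < vb)).2 hlt))
      (fun hnz => h1 ((test_read (R := R') (H := H) (c := rv < vb)).1 hnz))
  -- reading `rr` through updates of register `2`
  have rd : ∀ {R' : ℕ → ℕ} (t : ℕ), R' rr = rv → Function.update R' 2 t rr = rv := fun t h => by
    rw [Function.update_of_ne hrr2, h]
  -- the prefix branch: `[rv % vg₂ < vg₁]`
  refine (level (T := Tin + 4) hb₁ hb₁2 hb₁r Kept.rfl hRr hR₁ (fun hge₁ => ?_) (fun hlt₁ => ?_)).mono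
    (T' := Tin + 7) (fun _ h => h) (by omega)
  swap
  · set R₁ := Function.update R 2 (if rv < v₁ then 1 else 0) with hR₁def
    have K1 : Kept [2, rr] R R₁ := Kept.rfl.update h22 _
    have hR₁r : R₁ rr = rv := rd _ hRr
    have hR₁g₁ : R₁ g₁ = vg₁ := by rw [hR₁def, Function.update_of_ne hg₁2, hRg₁]
    have hR₁g₂ : R₁ g₂ = vg₂ := by rw [hR₁def, Function.update_of_ne hg₂2, hRg₂]
    have hR₁t : R₁ tgt = R tgt := by rw [hR₁def, Function.update_of_ne htgt2]
    refine Achieves.block (ops := [(.mod, r 20, r rr, r g₂), (.lt, r 20, r 20, r g₁),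
      (.add, pt tgt, r 20, im 0)]) ?_ (by simp only [List.length_cons, List.length_nil]; omega)
    refine ⟨Function.update (Function.update R₁ 20 (rv % vg₂)) 20 (if rv % vg₂ < vg₁ then 1 else 0), ?_, ?_⟩
    · simp (disch := first | omega | decide) only [execOps_cons, execOps_nil, execOp, Operand.write,
        Operand.read, merge_apply_of_lt hrr, merge_apply_of_lt hg₂, merge_apply_of_lt hg₁,
        merge_apply_of_lt htgt, merge_apply_of_lt (show (20 : ℕ) < 100 by decide),
        update_merge_of_lt _ _ (show (20 : ℕ) < 100 by decide), Function.update_self,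
        Function.update_of_ne hg₁20, Function.update_of_ne htgt20,
        hR₁r, hR₁g₁, hR₁g₂, hR₁t, BinOp.eval_mod, BinOp.eval_lt]
      rw [update_merge_of_le _ _ hT, BinOp.eval_add_of_lt (by split_ifs <;> omega), Nat.add_zero]
      simp [edBit, hlt₁, ite_eq_toNat_decide]
    · intro a ha
      simp only [List.mem_cons, not_or] at ha
      rw [Function.update_of_ne ha.2.1, Function.update_of_ne ha.2.1, hR₁def, Function.update_of_ne ha.1]
  set R₁ := Function.update R 2 (if rv < v₁ then 1 else 0) with hR₁def
  have K1 : Kept [2, rr] R R₁ := Kept.rfl.update h22 _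
  refine (level (T := Tin + 1) hb₂ hb₂2 hb₂r K1 (rd _ hRr) hR₂ (fun hge₂ => ?_) (fun hlt₂ => ?_)).mono
    (T' := Tin + 4) (fun _ h => h) (by omega)
  swap
  · -- the range of `z`: `rr := rv - v₁`, then `inner`
    set R₂ := Function.update R₁ 2 (if rv < v₂ then 1 else 0) with hR₂def
    have K2 : Kept [2, rr] R R₂ := K1.update h22 _
    have hsub : Achieves W O (op .sub (r rr) (r rr) (r b₁)) (merge R₂ H)
        (fun m => m = merge (Function.update R₂ rr (rv - v₁)) H) 1 := by
      refine Achieves.op ?_ le_rfl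
      simp only [Operand.write, Operand.read, merge_apply_of_lt hrr, merge_apply_of_lt hb₁,
        update_merge_of_lt _ _ hrr, hR₂def, hR₁def, Function.update_of_ne hrr2,
        Function.update_of_ne hb₁2, hRr, hR₁, BinOp.eval_sub_of_le (not_lt.1 hge₁) hrv]
    refine (Achieves.seq (T₁ := 1) (T₂ := Tin) hsub fun m hm => ?_).mono (T' := Tin + 1)
      (fun _ h => h) (by omega)
    subst hm
    have K2' := K2.update (show rr ∈ [2, rr] by simp) (rv - v₁)
    have := hinner (not_lt.1 hge₁) hlt₂ _ K2' (by rw [Function.update_self])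
    refine this.mono (Q' := Post (2 :: 20 :: rr :: Sin) R _) (fun m hm => ?_) le_rfl
    obtain ⟨R'', hm, hK''⟩ := hm
    refine ⟨R'', ?_, (K2'.trans hK'').mono (by simp; tauto)⟩
    rw [hm]; simp [edBit, hge₁, hlt₂]
  set R₂ := Function.update R₁ 2 (if rv < v₂ then 1 else 0) with hR₂def
  have K2 : Kept [2, rr] R R₂ := K1.update h22 _
  refine (level (T := Tin - 2) hb₃ hb₃2 hb₃r K2 (rd _ (rd _ hRr)) hR₃ (fun hge₃ => ?_)
    (fun hlt₃ => ?_)).mono (T' := Tin + 1) (fun _ h => h) (by omega)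
  · -- the separator: `0`
    set R₃ := Function.update R₂ 2 (if rv < v₃ then 1 else 0) with hR₃def
    have K3 : Kept [2, rr] R R₃ := K2.update h22 _
    have hR₃t : R₃ tgt = R tgt := K3 tgt (by simp [htgt2, Ne.symm hrrt])
    have := achieves_write (W := W) (O := O) (R := R₃) (H := H) (v := 0) ([] : List ℕ) htgt
      (hR₃t ▸ hT) (by omega) (show 1 ≤ Tin - 2 by omega)
    rw [hR₃t] at this
    refine this.mono (Q' := Post (2 :: 20 :: rr :: Sin) R _) (fun m hm => ?_) le_rfl
    obtain ⟨R'', hm, hK'⟩ := hm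
    refine ⟨R'', ?_, (K3.trans hK').mono (by simp)⟩
    rw [hm]; simp [edBit, hge₁, hge₂, hge₃]
  · -- the suffix branch: `[¬ ((rv - v₂) % vg₂ < vg₁)]`
    set R₃ := Function.update R₂ 2 (if rv < v₃ then 1 else 0) with hR₃def
    have K3 : Kept [2, rr] R R₃ := K2.update h22 _
    have hR₃r : R₃ rr = rv := rd _ (rd _ (rd _ hRr))
    have hR₃g₁ : R₃ g₁ = vg₁ := by
      rw [hR₃def, Function.update_of_ne hg₁2, hR₂def, Function.update_of_ne hg₁2, hR₁def,
        Function.update_of_ne hg₁2, hRg₁]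
    have hR₃g₂ : R₃ g₂ = vg₂ := by
      rw [hR₃def, Function.update_of_ne hg₂2, hR₂def, Function.update_of_ne hg₂2, hR₁def,
        Function.update_of_ne hg₂2, hRg₂]
    have hR₃b₂ : R₃ b₂ = v₂ := by
      rw [hR₃def, Function.update_of_ne hb₂2, hR₂def, Function.update_of_ne hb₂2, hR₁def,
        Function.update_of_ne hb₂2, hR₂]
    have hR₃t : R₃ tgt = R tgt := by
      rw [hR₃def, Function.update_of_ne htgt2, hR₂def, Function.update_of_ne htgt2, hR₁def,
        Function.update_of_ne htgt2]
    refine Achieves.block (ops := [(.sub, r 20, r rr, r b₂), (.mod, r 20, r 20, r g₂),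
      (.lt, r 20, r 20, r g₁), (.lt, r 20, r 20, im 1), (.add, pt tgt, r 20, im 0)]) ?_
      (by simp only [List.length_cons, List.length_nil]; omega)
    refine ⟨Function.update (Function.update (Function.update (Function.update R₃ 20 (rv - v₂)) 20
      ((rv - v₂) % vg₂)) 20 (if (rv - v₂) % vg₂ < vg₁ then 1 else 0)) 20
      (if (if (rv - v₂) % vg₂ < vg₁ then 1 else 0) < 1 then 1 else 0), ?_, ?_⟩
    · simp (disch := first | omega | decide) only [execOps_cons, execOps_nil, execOp, Operand.write,
        Operand.read, merge_apply_of_lt hrr, merge_apply_of_lt hg₂, merge_apply_of_lt hg₁,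
        merge_apply_of_lt hb₂, merge_apply_of_lt htgt, merge_apply_of_lt (show (20 : ℕ) < 100 by decide),
        update_merge_of_lt _ _ (show (20 : ℕ) < 100 by decide), Function.update_self,
        Function.update_of_ne hg₁20, Function.update_of_ne hg₂20,
        Function.update_of_ne htgt20, hR₃r, hR₃g₁, hR₃g₂, hR₃b₂, hR₃t,
        BinOp.eval_mod, BinOp.eval_lt, BinOp.eval_sub_of_le (not_lt.1 hge₂) hrv]
      rw [update_merge_of_le _ _ hT, BinOp.eval_add_of_lt (by split_ifs <;> omega), Nat.add_zero]
      simp only [edBit, hge₁, hge₂, hlt₃, if_false, if_true, ite_eq_toNat_decide, decide_toNat_lt_one]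
    · intro a ha
      simp only [List.mem_cons, not_or] at ha
      rw [Function.update_of_ne ha.2.1, Function.update_of_ne ha.2.1, Function.update_of_ne ha.2.1,
        Function.update_of_ne ha.2.1, hR₃def, Function.update_of_ne ha.1, hR₂def,
        Function.update_of_ne ha.1, hR₁def, Function.update_of_ne ha.1]
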